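import Summits.BirchSwinnertonDyer.BirchSwinnertonDyer.Theorems.Rank2ObservatoryThreeIsoRow
import Summits.BirchSwinnertonDyer.BirchSwinnertonDyer.Theorems.Rank2ObservatoryThreeIsoKField
import Summits.BirchSwinnertonDyer.BirchSwinnertonDyer.Theorems.Rank2ObservatoryThreeIsoNormCut
import Summits.BirchSwinnertonDyer.BirchSwinnertonDyer.Theorems.Rank2ObservatoryThreeIsoPrimes
import Summits.BirchSwinnertonDyer.BirchSwinnertonDyer.Theorems.Rank2ObservatoryThreeIsoInert
import Summits.BirchSwinnertonDyer.BirchSwinnertonDyer.Theorems.Rank2ObservatoryThreeIsoEhatClass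
import Summits.BirchSwinnertonDyer.BirchSwinnertonDyer.Theorems.Rank2ObservatoryThreeIsoRowKit
import Summits.BirchSwinnertonDyer.BirchSwinnertonDyer.Theorems.Rank2ObservatoryThreeIsoIndexLog
import Summits.BirchSwinnertonDyer.BirchSwinnertonDyer.Theorems.Rank2ObservatoryThreeIsoCertE
import Summits.BirchSwinnertonDyer.BirchSwinnertonDyer.Theorems.Rank2ObservatoryThreeIsoCertK
import Summits.ABC.ABC.Theorems.KenkuLevelTwentySixMWReduction
import Mathlib.Tactic.NormNum.Prime
import HarnessLib

/-!
# `KenkuPrintedLevels` (stmt-ABC-18224) (ii), level `26`: `rank_ℤ 26a1(ℚ) = 0` by `3`-isogeny descent,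
# hence `26a1(ℚ) = {O, (0, ±52)}` (`hMW`) and "no cyclic rational `26`-isogeny" modulo ONE cite-only fact

`Summits/ABC/ABC/Theorems/KenkuLevelTwentySixRankZero.lean` — unit `abc-inputs-pr-1` (KEY KENKU26, row
I-07/26; PROOFS ONLY: 0 definitions, 0 named facts; `--supports stmt-ABC-18224 --as helper`). Level-`26`
twin of `KenkuLevelThirtyFiveRankZero.lean` (unit `abc-inputs-pr-4`), whose proof it follows line by line.
The descent statement of `KenkuLevelTwentySixMWReduction.lean`,
`(threeTorsionModel (7 : ℚ) 52).mordellWeilRank = 0` (Cremona `26a1`: `r = 0`), is PROVED as one more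
row of the tree's per-curve `3`-isogeny-descent kit (BSD rank-2 observatory, KERNEL-3ISO, kits
`Summit.BirchSwinnertonDyer.BirchSwinnertonDyer.Rank2Observatory.ThreeIso.*`; Cohen GTM 239 §8.4,
Cohen–Pazuki 2009) on the model `E_{m,s} : y² = x³ + (mx + s)²`, `(m, s) = (7, 52)`
(`Δ = -2¹⁵·13³`, `4m³ - 27s = -32`, `81s - 12m³ = 96`):

* E-side (`ℚ`): `K(S,3)`-classes supported on `primeFactors (2s) = {2, 13}` (`3²` classes); 3 local-kill
  certificates at level `2³` — the `2`-minimised torsors `X³ + 2Y³ + 52Z³ - 14XYZ`,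
  `169X³ + 2Y³ + 676Z³ - 182XYZ`, `28561X³ + 2Y³ + 8788Z³ - 2366XYZ` of the classes `2`, `2·13`, `2·13²`
  have no primitive zero modulo `8` (and the inverse classes `2²`, `2²13²`, `2²13` die with them) — leave
  `#Im κ ≤ 3 < 3²` (the surviving classes `1, 13, 13²` are `κ(O), κ(∓T)`): `2` is a prime of NON-split
  multiplicative reduction (`I₃`, `c₂ = 1`), and `2` is not a cube in `ℚ₂·`-classes of these torsors;
* Ê-side (`K = ℚ(ζ₃)`, `η = ζ₃`, `θ₀ = 1 + 2η`): `2θ₀(81s - 12m³) = 2θ₀·96 = -θ₀³·2⁶` over the prime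
  family `P = {θ₀, 2}` (`2` inert), no split primes, so the support law with norm cut
  (`exists_descentEhat_class`) leaves the `3` classes `[ζ^j]`, of which ONE certificate at level `13¹`
  (the torsor `r³ - 3r²t - 9rt² + 3t³ + 42r²v + 126t²v + 192v³` of `[ζ]` has no primitive zero modulo
  `13`: `E` is split multiplicative at `13` with `c₁₃(E) = 3` (`T = (0, 52)` reduces to the node),
  `c₁₃(Ê) = 1`, so the `φ`-local image at `13` is trivial while `ζ₃` is not a cube in `ℚ₁₃`) leaves
  `#Im κ' ≤ 1 < 3¹`;
* count (log rule `ThreeIso.mordellWeilRank_le_of_images_log`): `3^(r+1) ≤ 3¹ · 3⁰`, so `r = 0`.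

Results: `Curve26a1Descent.model_mordellWeilRank_le_zero`, `mordellWeilRank_26a1_eq_zero`; with
`KenkuLevelTwentySixMWReduction.lean` (rank `0` + Mordell–Weil + reduction mod `3`, `11`):
**`mordellWeil_26a1 : ∀ X Y : ℚ, Y² = X³ + (7X + 52)² → X = 0`** — the displayed binder `hMW` of
`KenkuLevelTwentySixCertificate.lean`, now a THEOREM — and
**`isCyclic_degree_ne_twentySix (h13 : kleinFrickeThirteen_exists_j_eq)`**: no elliptic curve over `ℚ`
admits a cyclic `ℚ`-isogeny of degree `26`, modulo the ONE cite-only fact Klein–Fricke at `13`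
(`Literature.NumberTheory.EllipticCurves.kleinFrickeThirteen_exists_j_eq`, consumed BY NAME) and nothing
else (`fibreProduct_twentySix_empty : D₂₆` is unconditional).

HONESTY. An INPUTS→UNCONDITIONAL library theorem at abc distance 0 (row I-07/26): Kenku's level `26` is
PROVED MODULO ONE CITE-ONLY FACT, not proved; the item stmt-ABC-18224 is NOT closed by this file; abc moved
by 0; NOT abc; typed ≠ proved.

References: [Cohen2007NumberTheoryI] §8.4, Prop. 8.4.8; [CohenPazuki2009] Prop. 2.2, Thm. 3.1;
[CremonaAlgorithms1997] Table 1, `N = 26`, curve `A1` (`r = 0`, `|T| = 3`); [Kenku1982] Thm. 1.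
-/

-- `Summit.ABC.ABC` is the mandated summit-side namespace (CONVENTIONS §2); the duplicate is deliberate.
set_option linter.dupNamespace false

noncomputable section

open scoped Classical

namespace Summit.ABC.ABC.Theorems

open NumberField WeierstrassCurve
open Literature.NumberTheory.EllipticCurves Literature.NumberTheory.EllipticCurves.MordellDescent
open Summit.BirchSwinnertonDyer.BirchSwinnertonDyer.Rank2Observatory.ThreeIso

namespace Curve26a1Descent

/-- The model `E_{7,52}` is elliptic: `16 s³ (4m³ - 27s) ≠ 0`. [folklore] -/
theorem model_isElliptic : (threeTorsionModel (((7 : ℤ) : ℚ)) (((52 : ℤ) : ℚ))).IsElliptic :=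
  (isElliptic_threeTorsionModel_iff _ _).mpr (by norm_num)

/-- `(E_{7,52}, E'_{7,52})` is a Vélu three-pair. [folklore] -/
theorem isVeluThreePair : IsVeluThreePair (((7 : ℤ) : ℚ)) (((52 : ℤ) : ℚ))
    (threeTorsionModel (((7 : ℤ) : ℚ)) (((52 : ℤ) : ℚ)))
    (threeIsogenyCodomain (((7 : ℤ) : ℚ)) (((52 : ℤ) : ℚ))) :=
  isVeluThreePair_threeTorsionModel (by rw [Δ_threeTorsionModel]; norm_num)

/-! ### Ê-side (`K = ℚ(ζ₃)`): the prime family `P = {θ₀, 2}` in integer coordinates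

`P` = `1 + 2η`, `2 + 0η`; norm forms `3`, `4`; no split primes. -/

section Ehat

variable {K : Type*} [Field K] [NumberField K] [IsCyclotomicExtension {3} ℚ K] {ζ : K}
  (hζ : IsPrimitiveRoot ζ 3)

omit [IsCyclotomicExtension {3} ℚ K] in
/-- The factorisation `2θ₀(81s - 12m³) = 2θ₀·96 = (-1) · θ₀^3 · 2^6` over `P` (`3 = -θ₀²`). [folklore] -/
theorem ehat_fac : 2 * (2 * hζ.toInteger + 1) * ((81 * (52 : ℤ) - 12 * (7 : ℤ) ^ 3 : ℤ) : 𝓞 K) =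
    ((-1 : (𝓞 K)ˣ) : 𝓞 K) * ∏ q ∈ ({((1 : ℤ) : 𝓞 K) + (2 : ℤ) * hζ.toInteger,
      ((2 : ℤ) : 𝓞 K) + (0 : ℤ) * hζ.toInteger} : Finset (𝓞 K)),
      q ^ (fun q => if q = ((1 : ℤ) : 𝓞 K) + (2 : ℤ) * hζ.toInteger then 3
        else if q = ((2 : ℤ) : 𝓞 K) + (0 : ℤ) * hζ.toInteger then 6 else 1) q := by
  rw [Finset.prod_pair (by simp +decide only [ne_eq, coords_eq_iff hζ])]
  simp +decide only [reduceIte, coords_eq_iff hζ, Units.val_neg, Units.val_one, neg_mul, one_mul]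
  push_cast
  linear_combination (256 * (2 * hζ.toInteger + 1)) * toInteger_sq hζ

set_option maxHeartbeats 4000000 in
/-- **Ê-side support law** (index form for `ThreeIso.ehat_descent_mem_of_certs`, no split primes): every
`3`-descent value of an affine rational point of `Ê` over `K = ℚ(ζ₃)` is the class of `ζ^j`, `j ∈ 𝔽₃` —
`exists_descentEhat_class` on `P = {θ₀, 2}` (self-conjugate); the norm cut kills every exponent.
[cite: Cohen2007NumberTheoryI, Prop. 8.4.8 (3); CohenPazuki2009, Prop. 2.2] -/
theorem ehat_supp (σ : K ≃ₐ[ℚ] K) (hσ : σ ζ = ζ ^ 2) (X Y : ℚ)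
    (hQ : (threeIsogenyCodomain (((7 : ℤ) : ℚ)) (((52 : ℤ) : ℚ))).toAffine.Nonsingular X Y) :
    ∃ w : Fin 3 × (Fin 0 → Fin 3),
      cubeClass ((Y : K) - (2 * ζ + 1) * (((((7 : ℤ) : ℚ)) : K) * ((X : K) + 4 * ((((7 : ℤ) : ℚ)) : K) ^ 2 / 3)
          + (27 * ((((52 : ℤ) : ℚ)) : K) - 4 * ((((7 : ℤ) : ℚ)) : K) ^ 3) / 9)) =
        cubeClass (ζ ^ ((w).1 : ℕ) * ∏ ℓ : Fin 0,
          ((((((![] : Fin 0 → ℤ × ℤ) ℓ).1 : 𝓞 K) +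
              (((![] : Fin 0 → ℤ × ℤ) ℓ).2 : ℤ) * hζ.toInteger : 𝓞 K) : K) ^ (((w).2 ℓ : Fin 3) : ℕ) *
            (((((![] : Fin 0 → ℤ × ℤ) ℓ).1 : 𝓞 K) +
              (((![] : Fin 0 → ℤ × ℤ) ℓ).2 : ℤ) * hζ.toInteger : 𝓞 K) : K) ^ ((3 - (((w).2 ℓ : Fin 3) : ℕ)) % 3))) := by
  -- the primes `θ₀ = 1 + 2η ~ λ` (ramified), `2` (inert, `≡ 2 (mod 3)`); non-associated (norm forms
  -- `3, 4`); each is its own conjugate up to a unit [cite: IrelandRosen1990, Prop. 9.1.4]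
  obtain ⟨j, k, hj, hk, hcut, hcl⟩ := exists_descentEhat_class hζ σ hσ isVeluThreePair
    ({((1 : ℤ) : 𝓞 K) + (2 : ℤ) * hζ.toInteger, ((2 : ℤ) : 𝓞 K) + (0 : ℤ) * hζ.toInteger}
      : Finset (𝓞 K))
    (by -- the members of `P` are prime
      intro q hq
      simp only [Finset.mem_insert, Finset.mem_singleton] at hq
      rcases hq with rfl | rfl
      · have : ((1 : ℤ) : 𝓞 K) + (2 : ℤ) * hζ.toInteger = 2 * hζ.toInteger + 1 := by push_cast; ring
        rw [this]; exact prime_two_mul_toInteger_add_one hζ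
      · exact prime_inert_coords hζ (q := 2) (by norm_num) (by norm_num))
    (by -- pairwise non-association
      intro q hq q' hq' hqq'
      simp only [Finset.mem_insert, Finset.mem_singleton] at hq hq'
      rcases hq with rfl | rfl <;> rcases hq' with rfl | rfl <;>
        first
        | rfl
        | exact absurd (norm_form_eq_of_associated hζ hqq') (by decide))
    (fun q => q) (fun q hq => hq) (fun q _ => rfl)
    (by
      simp only [Finset.mem_insert, Finset.mem_singleton, forall_eq_or_imp, forall_eq]
      refine ⟨?_, ?_⟩ <;> rw [conj_coords hζ σ hσ]
      · refine (Associated.of_eq ?_).trans (Associated.refl _).neg_left; push_cast; ring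
      · exact Associated.of_eq (by push_cast; ring))
    (-1) _ (ehat_fac hζ) hQ
  refine ⟨(⟨j, hj⟩, ![]), ?_⟩
  rw [hcl, Finset.prod_pair (by simp +decide only [ne_eq, coords_eq_iff hζ])]
  have hk1 : k (((1 : ℤ) : 𝓞 K) + (2 : ℤ) * hζ.toInteger) = 0 := by
    have hc := hcut (((1 : ℤ) : 𝓞 K) + (2 : ℤ) * hζ.toInteger) (by simp)
    have := hk (((1 : ℤ) : 𝓞 K) + (2 : ℤ) * hζ.toInteger); omega
  have hk2 : k (((2 : ℤ) : 𝓞 K) + (0 : ℤ) * hζ.toInteger) = 0 := by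
    have hc := hcut (((2 : ℤ) : 𝓞 K) + (0 : ℤ) * hζ.toInteger) (by simp)
    have := hk (((2 : ℤ) : 𝓞 K) + (0 : ℤ) * hζ.toInteger); omega
  rw [hk1, hk2, pow_zero, pow_zero, mul_one, mul_one]
  congr 1
  simp only [Finset.univ_eq_empty, Finset.prod_empty, mul_one]

end Ehat

set_option maxHeartbeats 4000000 in
/-- **`rank_ℤ E_{7,52}(ℚ) ≤ 0` by `3`-isogeny descent**, hypothesis-free: `#Im κ < 3²` (3 local-kill
certificates at `2³`), `#Im κ' < 3¹` (1 certificate at `13¹`), certificate lists checked by the kernel, so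
`3^(r+1) ≤ 3¹ · 3⁰` (log rule). [cite: Cohen2007NumberTheoryI, Prop. 8.4.8]
[cite: CohenPazuki2009, Prop. 2.2, Thm. 3.1] -/
theorem model_mordellWeilRank_le_zero :
    (threeTorsionModel (((7 : ℤ) : ℚ)) (((52 : ℤ) : ℚ))).mordellWeilRank ≤ 0 := by
  have h := isVeluThreePair
  haveI hK : IsCyclotomicExtension {3} ℚ (CyclotomicField 3 ℚ) := CyclotomicField.isCyclotomicExtension 3 ℚ
  have hζ := IsCyclotomicExtension.zeta_spec 3 ℚ (CyclotomicField 3 ℚ)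
  -- B1/B3a: the Ê-side descent map over K = ℚ(ζ₃) with ker κ' ≤ φ(E(ℚ)); complex conjugation
  obtain ⟨κ', hκ'val, hκ'ker⟩ := exists_descentHom_Ehat_cyclotomic hζ h
  obtain ⟨σ, hσ⟩ := exists_conj hζ
  -- E-side support: `primeFactors (2s) = {2, 13}`
  have hps : (2 * (52 : ℤ)).natAbs.primeFactors = Finset.univ.image (![2, 13] : Fin 2 → ℕ) := by
    rw [show (2 * (52 : ℤ)).natAbs = 2 ^ 3 * 13 by norm_num,
      Nat.primeFactors_mul (by norm_num) (by norm_num),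
      Nat.primeFactors_prime_pow (by norm_num) Nat.prime_two,
      (show Nat.Prime 13 by norm_num).primeFactors]
    decide
  -- Ê-side image bound: support law + certificate list (kit CertK), validity by the kernel
  have hS' := ehat_descent_mem_of_certs hζ h κ' hκ'val
    (![] : Fin 0 → ℤ × ℤ) (![] : Fin 0 → ℤ × ℤ) (fun ℓ => Fin.elim0 ℓ) (ehat_supp hζ σ hσ)
    ([(((1, ![]), 13, 1), (1, 1, 1, 1), (0, 1, 1), (1, Int.neg 3, Int.neg 9, 3, 42, 126, 192))]
      : List (((Fin 3 × (Fin 0 → Fin 3)) × ℕ × ℕ) × (ℕ × ℕ × ℕ × ℕ) × (ℤ × ℤ × ℤ) ×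
          (ℤ × ℤ × ℤ × ℤ × ℤ × ℤ × ℤ)))
    (by decide +kernel)
  -- log rule; E-side image bound: support law + certificate list (kit CertE)
  refine mordellWeilRank_le_of_images_log (G' := Additive (CubeUnits (CyclotomicField 3 ℚ))) h ?_ κ' hκ'ker
    _ hS' _ (fun κ hκ => descent_mem_of_certs h κ hκ (![2, 13] : Fin 2 → ℕ) hps (by decide)
      ([((![1, 0], 2, 3), (4, 1, 2, 1), (1, 2, 52, Int.neg 14)),
        ((![1, 1], 2, 3), (4, 1, 2, 1), (169, 2, 676, Int.neg 182)),
        ((![1, 2], 2, 3), (4, 1, 2, 1), (28561, 2, 8788, Int.neg 2366))]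
        : List (((Fin 2 → Fin 3) × ℕ × ℕ) × (ℕ × ℕ × ℕ × ℕ) × (ℤ × ℤ × ℤ × ℤ)))
      (by decide +kernel)) 1 0 0 ?_ ?_ (by norm_num)
  · exact three_nsmul_eq_zero
  · exact Finset.card_image_le.trans_lt (by decide +kernel)
  · exact Finset.card_image_le.trans_lt (by decide +kernel)

end Curve26a1Descent

/-- **`rank_ℤ 26a1(ℚ) = 0`** (Cremona, Table 1, `N = 26`, curve `A1`: `r = 0`), for the tree's model
`threeTorsionModel 7 52 = [0, 49, 0, 728, 2704]` of `26a1`: the descent statement of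
`KenkuLevelTwentySixMWReduction.lean`, PROVED by the `3`-isogeny descent above.
[cite: CremonaAlgorithms1997, Table 1, N = 26, curve A1 (r = 0)] [cite: Cohen2007NumberTheoryI, Prop. 8.4.8] -/
theorem mordellWeilRank_26a1_eq_zero : (threeTorsionModel (7 : ℚ) 52).mordellWeilRank = 0 := by
  have h := Curve26a1Descent.model_mordellWeilRank_le_zero
  push_cast at h
  exact Nat.le_zero.mp h

/-- **The Mordell–Weil group of `26a1`** (Cremona, Table 1, `N = 26`, curve `A1`: `r = 0`, `|T| = 3`):
every rational solution of `Y² = X³ + (7X + 52)²` has `X = 0`, i.e. `26a1(ℚ) = {O, (0, ±52)} ≅ ℤ/3` — the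
displayed binder `hMW` of `KenkuLevelTwentySixCertificate.lean` VERBATIM, now a theorem (rank `0` by
`3`-isogeny descent here; torsion by reduction modulo `3` and `11` in `KenkuLevelTwentySixMWReduction.lean`).
[cite: CremonaAlgorithms1997, Table 1, N = 26, curve A1 (r = 0, |T| = 3)] -/
theorem mordellWeil_26a1 : ∀ X Y : ℚ, Y ^ 2 = X ^ 3 + (7 * X + 52) ^ 2 → X = 0 :=
  mordellWeil_26a1_of_rank_zero mordellWeilRank_26a1_eq_zero

/-- **`D₂₆` unconditionally**: the Klein–Fricke `2 × 13` fibre product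
`(s + 16)³ · t = (t² + 5t + 13)(t⁴ + 7t³ + 20t² + 19t + 1)³ · s` has no rational point with `s t ≠ 0`
(the rational points of `X₀(26)` off `j ∈ {0, 1728, ∞}` — Mazur–Swinnerton-Dyer / Ogg), i.e. the
hypothesis `hPts` of `isCyclic_degree_ne_twentySix_of_points` DISCHARGED (coordinate certificate + genus-`2`
model + quotient `26a1` + `26a1(ℚ) ≅ ℤ/3`). [cite: Kenku1982, Thm. 1 and its proof, pp. 199–201] -/
theorem fibreProduct_twentySix_empty :
    ∀ s t : ℚ, s ≠ 0 → t ≠ 0 →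
      (s + 16) ^ 3 * t ≠ (t ^ 2 + 5 * t + 13) * (t ^ 4 + 7 * t ^ 3 + 20 * t ^ 2 + 19 * t + 1) ^ 3 * s :=
  fibreProduct_twentySix_empty_of_mordellWeil mordellWeil_26a1

/-- **Kenku's printed level `26` modulo ONE cite-only fact**: granted Klein–Fricke at level `13`
(`h13 : Literature.NumberTheory.EllipticCurves.kleinFrickeThirteen_exists_j_eq`, a classical theorem in
print, typed ≠ proved, consumed BY NAME), no elliptic curve over `ℚ` admits a cyclic `ℚ`-isogeny of degree
`26` (`Y₀(26)(ℚ) = ∅`; Kenku 1982, Thm. 1) — `isCyclic_degree_ne_twentySix_of_points h13` composed with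
`fibreProduct_twentySix_empty`, no other displayed input left. An INPUTS→UNCONDITIONAL library theorem;
stmt-ABC-18224 itself is NOT closed by it; NOT abc. [cite: Kenku1982, Thm. 1 and its proof, pp. 199–201] -/
theorem isCyclic_degree_ne_twentySix (h13 : kleinFrickeThirteen_exists_j_eq)
    (V V' : WeierstrassCurve ℚ) [V.IsElliptic] [V'.IsElliptic]
    (ψ : Isogeny V V') (hψ : ψ.IsCyclic) : ψ.degree ≠ 26 :=
  isCyclic_degree_ne_twentySix_of_points h13 fibreProduct_twentySix_empty V V' ψ hψ

end Summit.ABC.ABC.Theorems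

end
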